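import Summits.QuantumFields.YangMills.Theorems.BalabanUVNodesSpineReadingOfRecord13CoPHKComponentSizeLevels
import Literature.MathematicalPhysics.QuantumFieldTheory.Balaban1983to89.Node00.TwoRunSitePeierlsCoverFamily

/-!
# THE PEIERLS ASSEMBLY AT THE COMPONENT-SIZE READING — the per-level letter of `…ComponentSizeLevels` PRODUCED from ONE ENERGY LETTER per connected set of sites:
# «the weight fraction of the coarse classes whose level-`j` large-field region contains the connected `m`-set `S`» `≤ ε K j ^ m`, summed over the
# `≤ |sites| · (3^d − 1)^{2(m−1)}` members of `Node00.animalCoverFamily SiteTouch m` (union bound) — so the N20 face at the cardinality dial follows from the energy letters alone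

Cell `pub-ymgap`, YM-PLAN Track A (HUMAN RULING D-0062; width push D-0149); seat `pub-ymgap-dag-n20-d` (R134 (a) N20 NE7b s3 = the U5d ∕ `crOfRecord₁₃` lineage, its declarer)
gen 32; companion of `…CoPHKComponentSize` (p702765: `badKeyReadingOfBigComponent₁₃ ∕ bigDialOfCard₁₃`), `…CoPHKComponentSizeLevels` (p704298:
`relWeightBound_bigComponent_of_levelLetters`), `Node00/TwoRunSitePeierlsCover(Family)` (p709159 ∕ p709984: `touchingGraph`, `animalCoverFamily`,
`exists_mem_animalCoverFamily_subset_of_hasBigComponent`, `card_animalCoverFamily_siteTouch_le_pred`).  `--kind proof --supports stmt-QuantumFields-27366 --as helper` (K3⁸);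
COUNT-NEUTRAL; THEOREMS ONLY (0 `def`).  [LF-II] = [Balaban1989LargeFieldII].
WHY.  The per-level letter `a K j` of p704298 («fraction of coarse classes whose `Z_j` has a component of `≥ m K j` finest sites») is ENTROPY × ENERGY.  The entropy side is
in the tree (p706465 ∕ p707759 ∕ p709159 ∕ p709984): such a key's `Z_j` contains the site set of SOME member `(z, S)` of `animalCoverFamily SiteTouch (m K j)`, a finset of
`≤ |sites| · (3^d − 1)^{2(m−1)}` pairs.  This file performs the weighted union bound over that finset at a step-preserving key reading, so that the only remaining input is the
ENERGY letter per connected `S`: `Σ_{u ∈ coarse classes at K, ↑S ⊆ Z_j(u)} weight ≤ ε K j ^ (m K j) · Σ_{coarse classes} weight` — k-point large-field domination under each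
run's dressed density ([LF-II] (1.79) p.383 ∕ (1.89) p.387: a factor `exp(−O(1)p₀(g_j)²)` per large-field cube), NOT PRINTED as a two-run statement, NOT typed, NOT claimed.
WHAT IS HERE.  §1 [folklore] `sum_le_sum_sum_of_finite_cover` (a finite cover turns a sum over the covered set into a double sum, non-negative summand) · `exists_eq_mk_of_mem_classSetK₁₃`
(at a step-preserving dial every coarse class at step `K` IS `⟨K, y⟩` — the Σ-key at its own step, so that events indexed by site sets at step `K` can be stated without casts:
the event reading `fun _ u ↦ ∀ y, u = ⟨K, y⟩ → ↑S ⊆ (y.2 j)ᶜ`); §2 ★ `bad_level_subset_cover` (a coarse class with a big component at level `j` lies in the event class of some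
member of the cover family) and ★ `sum_bad_level_le_sum_cover` (the union bound); §3 ★★ `levelLetter_of_energyLetters_left ∕ _right` (ENERGY letters `ε K j` per member ⇒ the level
letter `a K j := |sites| · (3^d − 1)^{2(m K j − 1)} · ε K j ^ (m K j)`) and ★★★ `relWeightBound_card_of_energyLetters` (everything assembled: energy letters in both runs + `Σ_j a K j < 1`
+ summable ⇒ `RelWeightBound` at the coarse carriers with the bad class of `badKeyReadingOfBigComponent₁₃ N K₀ jcut (bigDialOfCard₁₃ K₀ m)`).
HONEST FRAMING.  [folklore] finite-sum bookkeeping BY NAME; the energy letters are HYPOTHESES (inhabited for no family today; NOT PRINTED as two-run statements; A6-shaped); NO weight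
is bounded here, NO estimate proved; nothing of Bałaban's asserted; NE7 ∕ NE7b ∕ NE7c NOT PRINTED for `d = 4` ∕ NOT proved; no `Provisos₁₃CoPH` inhabitant claimed (K0⁷ OPEN); K3⁸ v7
untouched; N19 ∕ N20 ∕ N21 ∕ N27 NOT discharged; counts UNMOVED (typed 28∕28 · discharged 8∕27); one finite four-torus programme at fixed `ε` — NOT ℝ⁴, NOT OS, NOT a mass gap, NOT
the Clay problem.  No `def`, no `instance`, no `notation`, no `sorry`; no decl below carries a cite tag.
-/

noncomputable section

open scoped BigOperators
open Finset

namespace YMDAG.UVSplit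

open Literature.MathematicalPhysics.QuantumFieldTheory.Balaban1983to89
open Literature.MathematicalPhysics.QuantumFieldTheory.Balaban1983to89.T4Continuum
open Literature.MathematicalPhysics.QuantumFieldTheory.Balaban1983to89.Node00
open T4WeightBudget (RelWeightBound)
open Summit.QuantumFields.YangMills.BalabanUVNodes.N21KeyedShellWeightShellZero (weightA₁₃_nonneg weightB₁₃_nonneg)
open Summit.QuantumFields.YangMills.BalabanUVNodes.N20KeyedRelWeightAtKeyReading (fst_eq_of_mem_classSetK₁₃)

variable {F : T4Family} {N : ℕ} [NeZero N]

/-! ## §1 Two bookkeeping lemmas -/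

/-- [folklore] **A FINITE COVER TURNS A SUM INTO A DOUBLE SUM**: if every element of `B ⊆ T` lies in `E k` for some `k ∈ J`, all `E k ⊆ T`, and `f ≥ 0` on `T`, then
`Σ_{B} f ≤ Σ_{k ∈ J} Σ_{E k} f`. [bookkeeping] -/
theorem sum_le_sum_sum_of_finite_cover {ι κ : Type*} [DecidableEq ι] (T B : Finset ι) (J : Finset κ) (E : κ → Finset ι) (f : ι → ℝ)
    (hBT : B ⊆ T) (hET : ∀ k ∈ J, E k ⊆ T) (hf : ∀ x ∈ T, 0 ≤ f x) (hcover : ∀ x ∈ B, ∃ k ∈ J, x ∈ E k) :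
    ∑ x ∈ B, f x ≤ ∑ k ∈ J, ∑ x ∈ E k, f x := by
  calc ∑ x ∈ B, f x ≤ ∑ x ∈ B, ∑ k ∈ J, (if x ∈ E k then f x else 0) := by
        refine Finset.sum_le_sum fun x hx => ?_
        obtain ⟨k, hk, hxk⟩ := hcover x hx
        have h0 : ∀ k' ∈ J, 0 ≤ (if x ∈ E k' then f x else 0) := fun k' _ => by
          split_ifs
          · exact hf x (hBT hx)
          · exact le_rfl
        calc f x = (if x ∈ E k then f x else 0) := (if_pos hxk).symm
          _ ≤ ∑ k' ∈ J, (if x ∈ E k' then f x else 0) := Finset.single_le_sum (f := fun k' => if x ∈ E k' then f x else 0) h0 hk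
    _ ≤ ∑ x ∈ T, ∑ k ∈ J, (if x ∈ E k then f x else 0) :=
        Finset.sum_le_sum_of_subset_of_nonneg hBT fun x hxT _ => Finset.sum_nonneg fun k' _ => by
          split_ifs
          · exact hf x hxT
          · exact le_rfl
    _ = ∑ k ∈ J, ∑ x ∈ T, (if x ∈ E k then f x else 0) := Finset.sum_comm
    _ = ∑ k ∈ J, ∑ x ∈ E k, f x := by
        refine Finset.sum_congr rfl fun k hk => ?_
        rw [Finset.sum_ite_mem, Finset.inter_eq_right.2 (hET k hk)]

section Step

variable (θ : Stage13HParams F N) (K₀ : ℕ) (g₀ : ℕ → ℝ) (kr : ℕ → (Σ K, SiteSeqKey F (K₀ + K)) → (Σ K, SiteSeqKey F (K₀ + K)))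

/-- **AT A STEP-PRESERVING DIAL EVERY COARSE CLASS AT STEP `K` IS `⟨K, y⟩`** for a key `y` at step `K₀ + K` — the Σ-packed key read at its own step, WITHOUT casts. [bookkeeping] -/
theorem exists_eq_mk_of_mem_classSetK₁₃ (hkr : ∀ (K : ℕ) (x : Σ K, SiteSeqKey F (K₀ + K)), x ∈ classSet₁₃ θ K₀ g₀ K → (kr K x).1 = K) (K : ℕ)
    {u : Σ K, SiteSeqKey F (K₀ + K)} (hu : u ∈ classSetK₁₃ θ K₀ g₀ kr K) : ∃ y : SiteSeqKey F (K₀ + K), u = ⟨K, y⟩ := by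
  have h1 : u.1 = K := fst_eq_of_mem_classSetK₁₃ θ K₀ g₀ kr hkr K hu
  obtain ⟨K', y⟩ := u
  subst h1
  exact ⟨y, rfl⟩

end Step

/-! ## §2 The cover at class level and the union bound -/

section Cover

variable (θ : Stage13HParams F N) (hP : θ.Provisos₁₃CoPH F N) (K₀ : ℕ) (g₀ : ℕ → ℝ) (os : List (ULoop F))
  (kr : ℕ → (Σ K, SiteSeqKey F (K₀ + K)) → (Σ K, SiteSeqKey F (K₀ + K))) (m : ℕ → ℕ → ℕ)

/-- ★ **A CLASS WITH A BIG COMPONENT AT LEVEL `j` LIES IN THE EVENT CLASS OF SOME COVER MEMBER** (step-preserving dial, `1 ≤ m K j`): the event reading of the member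
`p = (z, S)` is «`↑S ⊆ (y.2 j)ᶜ` for the key `y` with `u = ⟨K, y⟩`». [bookkeeping] -/
theorem bad_level_subset_cover (hkr : ∀ (K : ℕ) (x : Σ K, SiteSeqKey F (K₀ + K)), x ∈ classSet₁₃ θ K₀ g₀ K → (kr K x).1 = K) (K : ℕ) (t : ℝ) {j : ℕ}
    (h1 : 1 ≤ m K j) {u : Σ K, SiteSeqKey F (K₀ + K)}
    (hu : u ∈ badClassK₁₃ θ K₀ g₀ kr (fun _ u => HasBigComponent SiteTouch (bigDialOfCard₁₃ (N := N) K₀ m F θ hP g₀ os u.1 j) (u.2.2 j)ᶜ) K t) :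
    ∃ p ∈ animalCoverFamily (SiteTouch (P := F.P (K₀ + K)) (j := 0)) (m K j),
      u ∈ badClassK₁₃ θ K₀ g₀ kr (fun _ u => ∀ y : SiteSeqKey F (K₀ + K), u = ⟨K, y⟩ → (↑p.2 : Set (Site (F.P (K₀ + K)) 0)) ⊆ (y.2 j)ᶜ) K t := by
  obtain ⟨huS, hbig⟩ := (mem_badClassK₁₃_iff θ K₀ g₀ kr _ K t u).1 hu
  obtain ⟨y, rfl⟩ := exists_eq_mk_of_mem_classSetK₁₃ θ K₀ g₀ kr hkr K huS
  obtain ⟨p, hp, hpZ⟩ := exists_mem_animalCoverFamily_subset_of_hasBigComponent (SiteTouch (P := F.P (K₀ + K)) (j := 0)) (m := m K) (j := j) h1 hbig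
  refine ⟨p, hp, (mem_badClassK₁₃_iff θ K₀ g₀ kr _ K t _).2 ⟨huS, ?_⟩⟩
  intro y' hy'
  have hyy' : y = y' := eq_of_heq (Sigma.mk.inj hy').2
  rw [← hyy']
  exact hpZ

/-- ★ **THE UNION BOUND OVER THE COVER FAMILY** (step-preserving dial, non-negative summand on the coarse class set, `1 ≤ m K j`). [bookkeeping] -/
theorem sum_bad_level_le_sum_cover (hkr : ∀ (K : ℕ) (x : Σ K, SiteSeqKey F (K₀ + K)), x ∈ classSet₁₃ θ K₀ g₀ K → (kr K x).1 = K) (K : ℕ) (t : ℝ) {j : ℕ}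
    (h1 : 1 ≤ m K j) (f : (Σ K, SiteSeqKey F (K₀ + K)) → ℝ) (hf : ∀ u ∈ classSetK₁₃ θ K₀ g₀ kr K, 0 ≤ f u) :
    ∑ u ∈ badClassK₁₃ θ K₀ g₀ kr (fun _ u => HasBigComponent SiteTouch (bigDialOfCard₁₃ (N := N) K₀ m F θ hP g₀ os u.1 j) (u.2.2 j)ᶜ) K t, f u ≤
      ∑ p ∈ animalCoverFamily (SiteTouch (P := F.P (K₀ + K)) (j := 0)) (m K j),
        ∑ u ∈ badClassK₁₃ θ K₀ g₀ kr (fun _ u => ∀ y : SiteSeqKey F (K₀ + K), u = ⟨K, y⟩ → (↑p.2 : Set (Site (F.P (K₀ + K)) 0)) ⊆ (y.2 j)ᶜ) K t, f u := by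
  classical
  exact sum_le_sum_sum_of_finite_cover (classSetK₁₃ θ K₀ g₀ kr K) _ _ _ f (badClassK₁₃_subset θ K₀ g₀ kr _ K t)
    (fun p _ => badClassK₁₃_subset θ K₀ g₀ kr _ K t) hf (fun u hu => bad_level_subset_cover θ hP K₀ g₀ os kr m hkr K t h1 hu)

end Cover

/-! ## §3 The level letter from energy letters; the face assembled -/

section Assembly

variable (θ : Stage13HParams F N) (hP : θ.Provisos₁₃CoPH F N) (K₀ : ℕ) (g₀ : ℕ → ℝ) (os : List (ULoop F))
  (kr : ℕ → (Σ K, SiteSeqKey F (K₀ + K)) → (Σ K, SiteSeqKey F (K₀ + K))) (jcut : ℕ → ℕ) (m : ℕ → ℕ → ℕ)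

/-- ★★ **RUN A's LEVEL LETTER FROM ENERGY LETTERS**: if for every member `(z, S)` of the cover family the coarse classes whose key has `↑S ⊆ Z_j` weigh at most `ε K j ^ (m K j)`
of run A's total (`0 ≤ ε`), then the classes with a big component at level `j` weigh at most `|sites| · (3^d − 1)^{2(m K j − 1)} · ε K j ^ (m K j)` of it. [bookkeeping] -/
theorem levelLetter_of_energyLetters_left (hkr : ∀ (K : ℕ) (x : Σ K, SiteSeqKey F (K₀ + K)), x ∈ classSet₁₃ θ K₀ g₀ K → (kr K x).1 = K)
    [∀ K, DecidableRel (touchingGraph (SiteTouch (P := F.P (K₀ + K)) (j := 0))).Adj] {ε : ℕ → ℕ → ℝ} (hε : ∀ K j, 0 ≤ ε K j) (K : ℕ) {t : ℝ} {j : ℕ}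
    (h1 : 1 ≤ m K j)
    (hE : ∀ p ∈ animalCoverFamily (SiteTouch (P := F.P (K₀ + K)) (j := 0)) (m K j),
      ∑ u ∈ badClassK₁₃ θ K₀ g₀ kr (fun _ u => ∀ y : SiteSeqKey F (K₀ + K), u = ⟨K, y⟩ → (↑p.2 : Set (Site (F.P (K₀ + K)) 0)) ⊆ (y.2 j)ᶜ) K t,
          weightAK₁₃ θ hP K₀ g₀ os kr K t u ≤ ε K j ^ m K j * ∑ u ∈ classSetK₁₃ θ K₀ g₀ kr K, weightAK₁₃ θ hP K₀ g₀ os kr K t u) :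
    ∑ u ∈ badClassK₁₃ θ K₀ g₀ kr (fun _ u => HasBigComponent SiteTouch (bigDialOfCard₁₃ (N := N) K₀ m F θ hP g₀ os u.1 j) (u.2.2 j)ᶜ) K t,
        weightAK₁₃ θ hP K₀ g₀ os kr K t u ≤
      (Fintype.card (Site (F.P (K₀ + K)) 0) * ((3 : ℝ) ^ (F.P (K₀ + K)).d - 1) ^ (2 * (m K j - 1)) * ε K j ^ m K j) *
        ∑ u ∈ classSetK₁₃ θ K₀ g₀ kr K, weightAK₁₃ θ hP K₀ g₀ os kr K t u := by
  have htot : 0 ≤ ∑ u ∈ classSetK₁₃ θ K₀ g₀ kr K, weightAK₁₃ θ hP K₀ g₀ os kr K t u :=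
    Finset.sum_nonneg fun u _ => weightAK₁₃_nonneg θ hP K₀ g₀ os kr (fun x _ => weightA₁₃_nonneg F θ hP K₀ g₀ os K t x) u
  have hcard : ((animalCoverFamily (SiteTouch (P := F.P (K₀ + K)) (j := 0)) (m K j)).card : ℝ) ≤
      Fintype.card (Site (F.P (K₀ + K)) 0) * ((3 : ℝ) ^ (F.P (K₀ + K)).d - 1) ^ (2 * (m K j - 1)) := by
    have h := card_animalCoverFamily_siteTouch_le_pred (P := F.P (K₀ + K)) (j := 0) (m K j)
    have h3 : (1 : ℕ) ≤ 3 ^ (F.P (K₀ + K)).d := Nat.one_le_pow _ _ (by norm_num)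
    calc ((animalCoverFamily (SiteTouch (P := F.P (K₀ + K)) (j := 0)) (m K j)).card : ℝ)
        ≤ ((Fintype.card (Site (F.P (K₀ + K)) 0) * (3 ^ (F.P (K₀ + K)).d - 1) ^ (2 * (m K j - 1)) : ℕ) : ℝ) := by exact_mod_cast h
      _ = Fintype.card (Site (F.P (K₀ + K)) 0) * ((3 : ℝ) ^ (F.P (K₀ + K)).d - 1) ^ (2 * (m K j - 1)) := by
          push_cast [Nat.cast_sub h3]
          ring
  calc ∑ u ∈ badClassK₁₃ θ K₀ g₀ kr (fun _ u => HasBigComponent SiteTouch (bigDialOfCard₁₃ (N := N) K₀ m F θ hP g₀ os u.1 j) (u.2.2 j)ᶜ) K t,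
          weightAK₁₃ θ hP K₀ g₀ os kr K t u
      ≤ ∑ p ∈ animalCoverFamily (SiteTouch (P := F.P (K₀ + K)) (j := 0)) (m K j),
          ∑ u ∈ badClassK₁₃ θ K₀ g₀ kr (fun _ u => ∀ y : SiteSeqKey F (K₀ + K), u = ⟨K, y⟩ → (↑p.2 : Set (Site (F.P (K₀ + K)) 0)) ⊆ (y.2 j)ᶜ) K t,
            weightAK₁₃ θ hP K₀ g₀ os kr K t u :=
        sum_bad_level_le_sum_cover θ hP K₀ g₀ os kr m hkr K t h1 _
          (fun u _ => weightAK₁₃_nonneg θ hP K₀ g₀ os kr (fun x _ => weightA₁₃_nonneg F θ hP K₀ g₀ os K t x) u)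
    _ ≤ ∑ _p ∈ animalCoverFamily (SiteTouch (P := F.P (K₀ + K)) (j := 0)) (m K j),
          ε K j ^ m K j * ∑ u ∈ classSetK₁₃ θ K₀ g₀ kr K, weightAK₁₃ θ hP K₀ g₀ os kr K t u := Finset.sum_le_sum hE
    _ = (animalCoverFamily (SiteTouch (P := F.P (K₀ + K)) (j := 0)) (m K j)).card *
          (ε K j ^ m K j * ∑ u ∈ classSetK₁₃ θ K₀ g₀ kr K, weightAK₁₃ θ hP K₀ g₀ os kr K t u) := by rw [Finset.sum_const, nsmul_eq_mul]
    _ ≤ (Fintype.card (Site (F.P (K₀ + K)) 0) * ((3 : ℝ) ^ (F.P (K₀ + K)).d - 1) ^ (2 * (m K j - 1))) *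
          (ε K j ^ m K j * ∑ u ∈ classSetK₁₃ θ K₀ g₀ kr K, weightAK₁₃ θ hP K₀ g₀ os kr K t u) :=
        mul_le_mul_of_nonneg_right hcard (mul_nonneg (pow_nonneg (hε K j) _) htot)
    _ = _ := by ring

/-- ★★ **RUN B's LEVEL LETTER FROM ENERGY LETTERS**, likewise. [bookkeeping] -/
theorem levelLetter_of_energyLetters_right (hkr : ∀ (K : ℕ) (x : Σ K, SiteSeqKey F (K₀ + K)), x ∈ classSet₁₃ θ K₀ g₀ K → (kr K x).1 = K)
    [∀ K, DecidableRel (touchingGraph (SiteTouch (P := F.P (K₀ + K)) (j := 0))).Adj] {ε : ℕ → ℕ → ℝ} (hε : ∀ K j, 0 ≤ ε K j) (K : ℕ) {t : ℝ} {j : ℕ}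
    (h1 : 1 ≤ m K j)
    (hE : ∀ p ∈ animalCoverFamily (SiteTouch (P := F.P (K₀ + K)) (j := 0)) (m K j),
      ∑ u ∈ badClassK₁₃ θ K₀ g₀ kr (fun _ u => ∀ y : SiteSeqKey F (K₀ + K), u = ⟨K, y⟩ → (↑p.2 : Set (Site (F.P (K₀ + K)) 0)) ⊆ (y.2 j)ᶜ) K t,
          weightBK₁₃ θ hP K₀ g₀ os kr K t u ≤ ε K j ^ m K j * ∑ u ∈ classSetK₁₃ θ K₀ g₀ kr K, weightBK₁₃ θ hP K₀ g₀ os kr K t u) :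
    ∑ u ∈ badClassK₁₃ θ K₀ g₀ kr (fun _ u => HasBigComponent SiteTouch (bigDialOfCard₁₃ (N := N) K₀ m F θ hP g₀ os u.1 j) (u.2.2 j)ᶜ) K t,
        weightBK₁₃ θ hP K₀ g₀ os kr K t u ≤
      (Fintype.card (Site (F.P (K₀ + K)) 0) * ((3 : ℝ) ^ (F.P (K₀ + K)).d - 1) ^ (2 * (m K j - 1)) * ε K j ^ m K j) *
        ∑ u ∈ classSetK₁₃ θ K₀ g₀ kr K, weightBK₁₃ θ hP K₀ g₀ os kr K t u := by
  have htot : 0 ≤ ∑ u ∈ classSetK₁₃ θ K₀ g₀ kr K, weightBK₁₃ θ hP K₀ g₀ os kr K t u :=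
    Finset.sum_nonneg fun u _ => weightBK₁₃_nonneg θ hP K₀ g₀ os kr (fun x _ => weightB₁₃_nonneg F θ hP K₀ g₀ os K t x) u
  have hcard : ((animalCoverFamily (SiteTouch (P := F.P (K₀ + K)) (j := 0)) (m K j)).card : ℝ) ≤
      Fintype.card (Site (F.P (K₀ + K)) 0) * ((3 : ℝ) ^ (F.P (K₀ + K)).d - 1) ^ (2 * (m K j - 1)) := by
    have h := card_animalCoverFamily_siteTouch_le_pred (P := F.P (K₀ + K)) (j := 0) (m K j)
    have h3 : (1 : ℕ) ≤ 3 ^ (F.P (K₀ + K)).d := Nat.one_le_pow _ _ (by norm_num)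
    calc ((animalCoverFamily (SiteTouch (P := F.P (K₀ + K)) (j := 0)) (m K j)).card : ℝ)
        ≤ ((Fintype.card (Site (F.P (K₀ + K)) 0) * (3 ^ (F.P (K₀ + K)).d - 1) ^ (2 * (m K j - 1)) : ℕ) : ℝ) := by exact_mod_cast h
      _ = Fintype.card (Site (F.P (K₀ + K)) 0) * ((3 : ℝ) ^ (F.P (K₀ + K)).d - 1) ^ (2 * (m K j - 1)) := by
          push_cast [Nat.cast_sub h3]
          ring
  calc ∑ u ∈ badClassK₁₃ θ K₀ g₀ kr (fun _ u => HasBigComponent SiteTouch (bigDialOfCard₁₃ (N := N) K₀ m F θ hP g₀ os u.1 j) (u.2.2 j)ᶜ) K t,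
          weightBK₁₃ θ hP K₀ g₀ os kr K t u
      ≤ ∑ p ∈ animalCoverFamily (SiteTouch (P := F.P (K₀ + K)) (j := 0)) (m K j),
          ∑ u ∈ badClassK₁₃ θ K₀ g₀ kr (fun _ u => ∀ y : SiteSeqKey F (K₀ + K), u = ⟨K, y⟩ → (↑p.2 : Set (Site (F.P (K₀ + K)) 0)) ⊆ (y.2 j)ᶜ) K t,
            weightBK₁₃ θ hP K₀ g₀ os kr K t u :=
        sum_bad_level_le_sum_cover θ hP K₀ g₀ os kr m hkr K t h1 _
          (fun u _ => weightBK₁₃_nonneg θ hP K₀ g₀ os kr (fun x _ => weightB₁₃_nonneg F θ hP K₀ g₀ os K t x) u)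
    _ ≤ ∑ _p ∈ animalCoverFamily (SiteTouch (P := F.P (K₀ + K)) (j := 0)) (m K j),
          ε K j ^ m K j * ∑ u ∈ classSetK₁₃ θ K₀ g₀ kr K, weightBK₁₃ θ hP K₀ g₀ os kr K t u := Finset.sum_le_sum hE
    _ = (animalCoverFamily (SiteTouch (P := F.P (K₀ + K)) (j := 0)) (m K j)).card *
          (ε K j ^ m K j * ∑ u ∈ classSetK₁₃ θ K₀ g₀ kr K, weightBK₁₃ θ hP K₀ g₀ os kr K t u) := by rw [Finset.sum_const, nsmul_eq_mul]
    _ ≤ (Fintype.card (Site (F.P (K₀ + K)) 0) * ((3 : ℝ) ^ (F.P (K₀ + K)).d - 1) ^ (2 * (m K j - 1))) *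
          (ε K j ^ m K j * ∑ u ∈ classSetK₁₃ θ K₀ g₀ kr K, weightBK₁₃ θ hP K₀ g₀ os kr K t u) :=
        mul_le_mul_of_nonneg_right hcard (mul_nonneg (pow_nonneg (hε K j) _) htot)
    _ = _ := by ring

/-- ★★★ **THE N20 FACE AT THE CARDINALITY DIAL FROM ENERGY LETTERS ALONE** (step-preserving dial; thresholds `m K j ≥ 1`): energy letters `ε K j ≥ 0` per cover member in both runs,
with the resulting entropy-weighted level sums `Σ_{j ≤ jcut K} |sites| · (3^d − 1)^{2(m K j − 1)} · ε K j ^ (m K j)` below `1` and summable in `K`, give `RelWeightBound` at the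
coarse carriers with the bad class of `badKeyReadingOfBigComponent₁₃ N K₀ jcut (bigDialOfCard₁₃ K₀ m)`. [bookkeeping] -/
theorem relWeightBound_card_of_energyLetters (hkr : ∀ (K : ℕ) (x : Σ K, SiteSeqKey F (K₀ + K)), x ∈ classSet₁₃ θ K₀ g₀ K → (kr K x).1 = K)
    [∀ K, DecidableRel (touchingGraph (SiteTouch (P := F.P (K₀ + K)) (j := 0))).Adj] {ε : ℕ → ℕ → ℝ} (hε : ∀ K j, 0 ≤ ε K j) (hm : ∀ K j, 1 ≤ m K j)
    (hEA : ∀ (K : ℕ) (t : ℝ), |t| ≤ 1 → ∀ j ∈ Finset.Icc 1 (jcut K), ∀ p ∈ animalCoverFamily (SiteTouch (P := F.P (K₀ + K)) (j := 0)) (m K j),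
      ∑ u ∈ badClassK₁₃ θ K₀ g₀ kr (fun _ u => ∀ y : SiteSeqKey F (K₀ + K), u = ⟨K, y⟩ → (↑p.2 : Set (Site (F.P (K₀ + K)) 0)) ⊆ (y.2 j)ᶜ) K t,
          weightAK₁₃ θ hP K₀ g₀ os kr K t u ≤ ε K j ^ m K j * ∑ u ∈ classSetK₁₃ θ K₀ g₀ kr K, weightAK₁₃ θ hP K₀ g₀ os kr K t u)
    (hEB : ∀ (K : ℕ) (t : ℝ), |t| ≤ 1 → ∀ j ∈ Finset.Icc 1 (jcut K), ∀ p ∈ animalCoverFamily (SiteTouch (P := F.P (K₀ + K)) (j := 0)) (m K j),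
      ∑ u ∈ badClassK₁₃ θ K₀ g₀ kr (fun _ u => ∀ y : SiteSeqKey F (K₀ + K), u = ⟨K, y⟩ → (↑p.2 : Set (Site (F.P (K₀ + K)) 0)) ⊆ (y.2 j)ᶜ) K t,
          weightBK₁₃ θ hP K₀ g₀ os kr K t u ≤ ε K j ^ m K j * ∑ u ∈ classSetK₁₃ θ K₀ g₀ kr K, weightBK₁₃ θ hP K₀ g₀ os kr K t u)
    (hlt : ∀ K, ∑ j ∈ Finset.Icc 1 (jcut K),
      Fintype.card (Site (F.P (K₀ + K)) 0) * ((3 : ℝ) ^ (F.P (K₀ + K)).d - 1) ^ (2 * (m K j - 1)) * ε K j ^ m K j < 1)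
    (hsum : Summable fun K => ∑ j ∈ Finset.Icc 1 (jcut K),
      Fintype.card (Site (F.P (K₀ + K)) 0) * ((3 : ℝ) ^ (F.P (K₀ + K)).d - 1) ^ (2 * (m K j - 1)) * ε K j ^ m K j) :
    RelWeightBound 1 (classSetK₁₃ θ K₀ g₀ kr) (weightAK₁₃ θ hP K₀ g₀ os kr) (weightBK₁₃ θ hP K₀ g₀ os kr)
      (badClassK₁₃ θ K₀ g₀ kr (badKeyReadingOfBigComponent₁₃ N K₀ jcut (bigDialOfCard₁₃ K₀ m) F θ hP g₀ os))
      (fun K => ∑ j ∈ Finset.Icc 1 (jcut K),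
        Fintype.card (Site (F.P (K₀ + K)) 0) * ((3 : ℝ) ^ (F.P (K₀ + K)).d - 1) ^ (2 * (m K j - 1)) * ε K j ^ m K j) := by
  have ha0 : ∀ K j, 0 ≤ Fintype.card (Site (F.P (K₀ + K)) 0) * ((3 : ℝ) ^ (F.P (K₀ + K)).d - 1) ^ (2 * (m K j - 1)) * ε K j ^ m K j := by
    intro K j
    have h3 : (1 : ℝ) ≤ (3 : ℝ) ^ (F.P (K₀ + K)).d := one_le_pow₀ (by norm_num)
    exact mul_nonneg (mul_nonneg (Nat.cast_nonneg _) (pow_nonneg (by linarith) _)) (pow_nonneg (hε K j) _)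
  have hW := relWeightBound_bigComponent_of_levelLetters θ hP K₀ g₀ os kr jcut (bigDialOfCard₁₃ K₀ m) hkr
    (a := fun K j => Fintype.card (Site (F.P (K₀ + K)) 0) * ((3 : ℝ) ^ (F.P (K₀ + K)).d - 1) ^ (2 * (m K j - 1)) * ε K j ^ m K j)
    (b := fun K j => Fintype.card (Site (F.P (K₀ + K)) 0) * ((3 : ℝ) ^ (F.P (K₀ + K)).d - 1) ^ (2 * (m K j - 1)) * ε K j ^ m K j)
    ha0 (fun K t ht j hj => levelLetter_of_energyLetters_left θ hP K₀ g₀ os kr m hkr hε K (hm K j) (hEA K t ht j hj))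
    (fun K t ht j hj => levelLetter_of_energyLetters_right θ hP K₀ g₀ os kr m hkr hε K (hm K j) (hEB K t ht j hj))
    (fun K => by simpa only [max_self] using hlt K) (by simpa only [max_self] using hsum)
  simpa only [max_self] using hW

end Assembly

end YMDAG.UVSplit

end
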